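import Summits.MatrixMultiplication.MatrixMultiplication.Theorems.SoloBlindCorankOne

/-!
# The Kraft inequality (K₃) at corank one, in every rank

Sub-programme (K₃): for a zero-sum-free sequence `h` the Kraft mass `K(τ; S) = ∑_{T ⊆ S, ∑_T h = τ} 2^{-|T|}`
(`soloBlindMass`) should satisfy `K(τ; S) ≤ 1` for EVERY target `τ` (no H-goodness assumed).  Companion to
`SoloBlindCorankOne` (the H-good half, bound `1/2`):

* `soloBlind_kraft_corank_one` — if `B` is sum-distinct for `h`, `p ∉ B` (the value `h p` is unrestricted: it may
  repeat a value on `B`, so SEQUENCES of corank one are covered) and `h` is zero-sum free on `S = B ∪ {p}`, then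
  `K(τ; S) ≤ 1` for every `τ`, over every abelian group.  Proof: deletion identity
  `K(τ; S) = K(τ; B) + K(τ - h p; B) / 2`; both masses on `B` are `0` or `2^{-a}`; if both representations
  `A` (of `τ`) and `A'` (of `τ - h p`) exist then `A ≠ ∅`, since `A = ∅` means `τ = 0` and then `A' ∪ {p}` is a
  non-empty zero-sum; so `K ≤ 1/2 + 1/2`.
* `soloBlind_kraft_basis_add_one` — the linear-independence form: (K₃) for every zero-sum-free sequence of length
  `≤ rank + 1`, in every rank.

(K3.29 proves (K₃) for sequences of corank `≤ 3` by the finite type search; this is the corank-one certificate.)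
-/

namespace Summit.MatrixMultiplication.MatrixMultiplication.Theorems

open Finset

universe u

variable {ι : Type*} [DecidableEq ι]
variable {G : Type u} [AddCommGroup G] [DecidableEq G]

/-- (K₃) AT CORANK ONE (every rank, every abelian group, every target): for a sum-distinct `B`, `p ∉ B` and `h`
zero-sum free on `B ∪ {p}`, `K(τ; B ∪ {p}) ≤ 1`. -/
theorem soloBlind_kraft_corank_one {h : ι → G} {B : Finset ι} {p : ι} (hpB : p ∉ B)
    (hdist : ∀ A ⊆ B, ∀ A' ⊆ B, ∑ i ∈ A, h i = ∑ i ∈ A', h i → A = A')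
    (zsf : ∀ T ⊆ insert p B, T.Nonempty → ∑ i ∈ T, h i ≠ 0) (τ : G) :
    soloBlindMass h (insert p B) τ ≤ 1 := by
  have hpS : p ∈ insert p B := Finset.mem_insert_self p B
  rw [soloBlind_mass_erase h hpS τ, Finset.erase_insert hpB]
  have hR1 : (soloBlindSeqRepAll h B τ).card ≤ 1 := soloBlind_repAll_card_le_one_of_sumDistinct hdist τ
  have hR'1 : (soloBlindSeqRepAll h B (τ - h p)).card ≤ 1 :=
    soloBlind_repAll_card_le_one_of_sumDistinct hdist (τ - h p)
  have e2 := soloBlind_mass_le_pow_of_card_le_one h B (τ - h p) 0 hR'1 (fun T _ => Nat.zero_le _)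
  rw [pow_zero] at e2
  by_cases hR'ne : (soloBlindSeqRepAll h B (τ - h p)).Nonempty
  · obtain ⟨A', hA'⟩ := hR'ne
    -- a representation of `τ` inside `B` cannot be empty: `τ = 0` would make `A' ∪ {p}` a zero-sum
    have hRpos : ∀ T ∈ soloBlindSeqRepAll h B τ, 1 ≤ T.card := by
      intro T hT
      rw [Nat.one_le_iff_ne_zero]
      intro h0
      rw [Finset.card_eq_zero] at h0
      obtain ⟨-, hs⟩ := soloBlind_mem_seqRepAll.mp hT
      rw [h0, Finset.sum_empty] at hs
      obtain ⟨hA'B, hA's⟩ := soloBlind_mem_seqRepAll.mp hA'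
      have hpA' : p ∉ A' := fun hpA' => hpB (hA'B hpA')
      refine zsf (insert p A') (Finset.insert_subset_insert p hA'B) (Finset.insert_nonempty p A') ?_
      rw [Finset.sum_insert hpA', hA's, ← hs, add_sub_cancel]
    have e1 := soloBlind_mass_le_pow_of_card_le_one h B τ 1 hR1 hRpos
    rw [pow_one] at e1
    linarith
  · have hR'0 : soloBlindSeqRepAll h B (τ - h p) = ∅ := Finset.not_nonempty_iff_eq_empty.mp hR'ne
    have e0 : soloBlindMass h B (τ - h p) = 0 := by rw [soloBlindMass, hR'0, Finset.sum_empty]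
    have e1 := soloBlind_mass_le_pow_of_card_le_one h B τ 0 hR1 (fun T _ => Nat.zero_le _)
    rw [pow_zero] at e1
    rw [e0]
    linarith

section LinearIndependence

variable {R : Type*} [Ring R] [Nontrivial R] [Module R G]

/-- (K₃) FOR SEQUENCES OF LENGTH `≤ rank + 1`, EVERY RANK: if `h` is linearly independent on `B` (elementary form),
`p ∉ B` and `h` is zero-sum free on `B ∪ {p}`, then `K(τ; B ∪ {p}) ≤ 1` for every `τ`. -/
theorem soloBlind_kraft_basis_add_one {h : ι → G} {B : Finset ι} {p : ι} (hpB : p ∉ B)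
    (hli : ∀ g : ι → R, ∑ i ∈ B, g i • h i = 0 → ∀ i ∈ B, g i = 0)
    (zsf : ∀ T ⊆ insert p B, T.Nonempty → ∑ i ∈ T, h i ≠ 0) (τ : G) :
    soloBlindMass h (insert p B) τ ≤ 1 :=
  soloBlind_kraft_corank_one hpB (soloBlind_sumDistinct_of_linearIndependent (R := R) hli) zsf τ

end LinearIndependence

end Summit.MatrixMultiplication.MatrixMultiplication.Theorems
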